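import Summits.ValiantsHypothesis.ValiantsHypothesis.Theorems.BarrierLeverAnchoredDoorHitsLowerPairsConjZprime
import Summits.ValiantsHypothesis.ValiantsHypothesis.Theorems.BarrierLeverAnchoredDoorHitsLowerPairsDistinctAnchors

/-!
# Support item `AnchoredDoorHitsLowerPairs` (stmt-ValiantsHypothesis-22510), line `anchored-peeling`:
# THE REGISTERED RESIDUAL MINUS DISTINCT-ANCHOR PAIRS — the class `IsDAPair` of val-np-p4 g16's theorem, the v28 node
# `Stmt.stub_ltRestNonCanonRSWP` restated Theorems-side, the narrowed node `Stmt.stub_ltRestNonCanonRSWPD`, and the kernel glue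

Helper file (`--supports stmt-ValiantsHypothesis-22510`; cell valiant-natproofs, rung V4; prover seat val-np-p1 gen 27; memo
HOME/val-np-p1/g27/MEMO-DA-profile2-valnp1-g27.md §1–§3). Closes NO item.

WHY. The registered concluding node of line v28 is `Stmt.stub_ltRestNonCanonRSWP` (planner R41; Cruxes skeleton ll. 839–866): the residual of lower
pairs outside every landed kernel class at some profile `s ≥ 2`. The landed class it does NOT subtract is the oldest one: val-np-p4 g16's SYSTEM OF
DISTINCT ANCHORS (`DistinctAnchors.symbolicDet_ne_zero_of_distinctAnchors`, p-landed 2026-08-27): a bijection `σ` (`∅ ↔ ∅`) with pairwise distinct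
anchors `(A_k | B_k) ∈ anchors s h`, `A_k ⊆ u k`, `B_k ⊆ w (σ k)`. At `s = 2` this class contains EVERY explicit pair of the line's residual censuses
(all x-elimination instances, the Golay pair, the doubly non-nested-Hall pair of memo g26 §1 — kernel instance p232 in `…DAInstances`; exact max-flow
lab/da_flow.py), and by the min-cut form of its Hall condition (memo §2) a pair escapes it only if a sub-complex `R' ⊆ R` and a set `𝔅` of small faces of
`C` satisfy `|R'| − 1 > #{A ∈ R' : 1 ≤ |A| ≤ s} · #{B ∈ C ∖ 𝔅 : 1 ≤ |B| ≤ s} + #{W ∈ C : ∃ B ∈ 𝔅, B ⊆ W}` (or the mirror condition) — a DEEP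
sub-complex against few small faces; at `s = 2` no such lower pair is known below r ≈ 10⁸ (cube_n against tB(N,3)-type columns needs n ≳ 28).

CONTENTS. `DistinctAnchors.IsDAPair s u w` (the hypothesis of the landed theorem as one `Prop`), `symbolicDet_ne_zero_of_isDAPair`;
`Stmt.stub_ltRestNonCanonRSWP` = the registered v28 text VERBATIM (Theorems-side restatement for by-name credit); the glue of the skeleton
`stub_ltRestNonCanonRSW_of_rswp` re-proved here (K1′ + swap + x-certificates) and `anchoredDoorHitsLowerPairs_of_ltRestNonCanonRSWP` BY NAME;
**`Stmt.stub_ltRestNonCanonRSWPD`** := RSWP verbatim + «no system of distinct anchors at profile `s` in either orientation»; UNCONDITIONAL glue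
`stub_ltRestNonCanonRSWP_of_rswpd` (a 1:1 weakest-node narrowing candidate, planner's call) and `anchoredDoorHitsLowerPairs_of_ltRestNonCanonRSWPD`.

WHAT THIS IS NOT: neither node is proved; nothing on crux stmt-ValiantsHypothesis-14610 or on `VP` versus `VNP`.
-/

set_option linter.dupNamespace false

namespace Summit.ValiantsHypothesis.ValiantsHypothesis.Theorems.BarrierLever.AnchoredPeeling

/-! ## 1. The distinct-anchor class -/

namespace DistinctAnchors

/-- **`IsDAPair s u w`: the layout `(u, w)` carries a system of distinct anchors at profile `s`** — a bijection `σ` of row and column indices with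
`u k = ∅ ↔ w (σ k) = ∅` and anchors `anc k ∈ anchors s h` inside the matched entries of the nonempty rows, pairwise distinct (exactly the hypotheses
of `symbolicDet_ne_zero_of_distinctAnchors`). -/
def IsDAPair (s : ℕ) {h r : ℕ} (u w : Fin r → Finset (Fin h)) : Prop :=
  ∃ (σ : Equiv.Perm (Fin r)) (anc : Fin r → Finset (Fin h) × Finset (Fin h)),
    (∀ k, u k = ∅ ↔ w (σ k) = ∅) ∧
    (∀ k, u k ≠ ∅ → anc k ∈ anchors s h ∧ (anc k).1 ⊆ u k ∧ (anc k).2 ⊆ w (σ k)) ∧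
    (∀ k k', u k ≠ ∅ → u k' ≠ ∅ → anc k = anc k' → k = k')

/-- **A distinct-anchor pair is hit at profile `s`** (`symbolicDet_ne_zero_of_distinctAnchors`). -/
theorem symbolicDet_ne_zero_of_isDAPair {s h r : ℕ} {u w : Fin r → Finset (Fin h)} (hu : Function.Injective u) (hw : Function.Injective w)
    (hD : IsDAPair s u w) : symbolicDet s h r u w ≠ 0 := by
  obtain ⟨σ, anc, hempty, hanc, hinj⟩ := hD
  exact symbolicDet_ne_zero_of_distinctAnchors s h r u w hu hw σ hempty anc hanc hinj

/-- **… and at every profile `s' ≥ s`** (`symbolicDet_ne_zero_mono`). -/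
theorem symbolicDet_ne_zero_of_isDAPair_mono {s s' h r : ℕ} (hss : s ≤ s') {u w : Fin r → Finset (Fin h)} (hu : Function.Injective u)
    (hw : Function.Injective w) (hD : IsDAPair s u w) : symbolicDet s' h r u w ≠ 0 :=
  symbolicDet_ne_zero_mono hss (symbolicDet_ne_zero_of_isDAPair hu hw hD)

/-- **The swapped orientation:** a distinct-anchor system for `(w, u)` also certifies `(u, w)` (`symbolicDet_ne_zero_comm`). -/
theorem symbolicDet_ne_zero_of_isDAPair_swap {s h r : ℕ} {u w : Fin r → Finset (Fin h)} (hu : Function.Injective u) (hw : Function.Injective w)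
    (hD : IsDAPair s w u) : symbolicDet s h r u w ≠ 0 :=
  (symbolicDet_ne_zero_comm s h r u w).mpr (symbolicDet_ne_zero_of_isDAPair hw hu hD)

end DistinctAnchors

/-! ## 2. The registered node v28b, Theorems-side, and its glue -/

/-- **NODE v28b `stub_ltRestNonCanonRSWP` (planner R41; the registered concluding node of line v28), restated VERBATIM:** the v26 residual
`Stmt.stub_ltRestNonCanonRSW` with `2 ≤ s` and four more exclusions — not PT-certifiable at profile `s` (K1′, p705454) in either orientation and no
x-elimination certificate (`XElim.IsXCertPair`, p699080) in either orientation. WHY IT MIGHT FAIL: a residual pair outside every kernel class with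
vanishing symbolic minor at every profile (none known). -/
def Stmt.stub_ltRestNonCanonRSWP : Prop :=
  ∃ s h₀ : ℕ, 2 ≤ s ∧ ∀ h : ℕ, h₀ ≤ h → ∀ (r : ℕ) (u w : Fin r → Finset (Fin h)),
    Function.Injective u → Function.Injective w → IsLowerSet (Set.range u) → IsLowerSet (Set.range w) → 2 ≤ r →
    (∀ (a : Fin h) (W₀ : Finset (Fin h)) (𝒜 : Finset (Finset (Fin h))) (ρ : Finset (Fin h) → Finset (Fin h)), ¬ UQFData s u w a W₀ 𝒜 ρ) →
    (∀ (c : Fin h) (Z : Finset (Fin h)) (𝒜 : Finset (Finset (Fin h))) (ρ : Finset (Fin h) → Finset (Fin h)), ¬ UQFData s w u c Z 𝒜 ρ) →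
    ¬ Summit.ValiantsHypothesis.ValiantsHypothesis.Theorems.BarrierLever.AnchoredPeeling.IsRelApexPair u w → ¬ Summit.ValiantsHypothesis.ValiantsHypothesis.Theorems.BarrierLever.AnchoredPeeling.IsRelApexPair w u → ¬ Summit.ValiantsHypothesis.ValiantsHypothesis.Theorems.BarrierLever.AnchoredPeeling.LTCert u w → ¬ Summit.ValiantsHypothesis.ValiantsHypothesis.Theorems.BarrierLever.AnchoredPeeling.LTCert w u →
    (¬ ∃ (k : ℕ) (σ τ : Equiv.Perm (Fin h)), 1 ≤ k ∧ 2 * k + 1 ≤ h ∧ 2 ^ (k + 1) - 1 ≤ h ∧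
        (∀ U : Finset (Fin h), U ∈ Set.range u ↔ Summit.ValiantsHypothesis.ValiantsHypothesis.Theorems.BarrierLever.AnchoredPeeling.DecRow k h (U.map σ.toEmbedding)) ∧
        (∀ W : Finset (Fin h), W ∈ Set.range w ↔ Summit.ValiantsHypothesis.ValiantsHypothesis.Theorems.BarrierLever.AnchoredPeeling.DecCol k h (W.map τ.toEmbedding))) →
    (¬ ∃ (k : ℕ) (σ τ : Equiv.Perm (Fin h)), 1 ≤ k ∧ 2 * k + 1 ≤ h ∧ 2 ^ (k + 1) - 1 ≤ h ∧
        (∀ U : Finset (Fin h), U ∈ Set.range w ↔ Summit.ValiantsHypothesis.ValiantsHypothesis.Theorems.BarrierLever.AnchoredPeeling.DecRow k h (U.map σ.toEmbedding)) ∧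
        (∀ W : Finset (Fin h), W ∈ Set.range u ↔ Summit.ValiantsHypothesis.ValiantsHypothesis.Theorems.BarrierLever.AnchoredPeeling.DecCol k h (W.map τ.toEmbedding))) →
    (¬ ∃ (m : ℕ) (σ τ : Equiv.Perm (Fin h)), 1 ≤ m ∧ 2 * m + 2 ≤ h ∧ 2 ^ (m + 1) + 2 ^ m - 1 ≤ h ∧
        (∀ U : Finset (Fin h), U ∈ Set.range u ↔ Summit.ValiantsHypothesis.ValiantsHypothesis.Theorems.BarrierLever.AnchoredPeeling.SplitRow m h (U.map σ.toEmbedding)) ∧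
        (∀ W : Finset (Fin h), W ∈ Set.range w ↔ Summit.ValiantsHypothesis.ValiantsHypothesis.Theorems.BarrierLever.AnchoredPeeling.SplitCol m h (W.map τ.toEmbedding))) →
    (¬ ∃ (m : ℕ) (σ τ : Equiv.Perm (Fin h)), 1 ≤ m ∧ 2 * m + 2 ≤ h ∧ 2 ^ (m + 1) + 2 ^ m - 1 ≤ h ∧
        (∀ U : Finset (Fin h), U ∈ Set.range w ↔ Summit.ValiantsHypothesis.ValiantsHypothesis.Theorems.BarrierLever.AnchoredPeeling.SplitRow m h (U.map σ.toEmbedding)) ∧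
        (∀ W : Finset (Fin h), W ∈ Set.range u ↔ Summit.ValiantsHypothesis.ValiantsHypothesis.Theorems.BarrierLever.AnchoredPeeling.SplitCol m h (W.map τ.toEmbedding))) →
    ¬ _root_.Summit.ValiantsHypothesis.ValiantsHypothesis.Theorems.BarrierLever.AnchoredPeeling.IsWApexPair u w → ¬ _root_.Summit.ValiantsHypothesis.ValiantsHypothesis.Theorems.BarrierLever.AnchoredPeeling.IsWApexPair w u →
    (¬ ∃ (a c : Fin r → ℕ) (Θ : Finset (Fin h) × Finset (Fin h) → ℂ) (Φ Ψ : Finset (Fin h) × Finset (Fin h) → Fin h → ℂ),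
        (∀ i j, a i ≤ c j ∨ a i + s * (u i).card ≤ (w j).card + c j) ∧
        (Matrix.of fun i j : Fin r => if c j ≤ a i then _root_.Summit.ValiantsHypothesis.ValiantsHypothesis.Theorems.BarrierLever.AnchoredPeeling.PT.ptEntry s (a i - c j) Θ Φ Ψ (w j) (u i) else 0).det ≠ 0) →
    (¬ ∃ (a c : Fin r → ℕ) (Θ : Finset (Fin h) × Finset (Fin h) → ℂ) (Φ Ψ : Finset (Fin h) × Finset (Fin h) → Fin h → ℂ),
        (∀ i j, a i ≤ c j ∨ a i + s * (w i).card ≤ (u j).card + c j) ∧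
        (Matrix.of fun i j : Fin r => if c j ≤ a i then _root_.Summit.ValiantsHypothesis.ValiantsHypothesis.Theorems.BarrierLever.AnchoredPeeling.PT.ptEntry s (a i - c j) Θ Φ Ψ (u j) (w i) else 0).det ≠ 0) →
    ¬ _root_.Summit.ValiantsHypothesis.ValiantsHypothesis.Theorems.BarrierLever.AnchoredPeeling.XElim.IsXCertPair u w → ¬ _root_.Summit.ValiantsHypothesis.ValiantsHypothesis.Theorems.BarrierLever.AnchoredPeeling.XElim.IsXCertPair w u →
    symbolicDet s h r u w ≠ 0

/-- **Glue (as in the v28 skeleton, kernel-checked here): RSWP ⟹ the v26 node RSW** — PT-certifiable pairs by K1′ (`PT.symbolicDet_ne_zero_of_ptEntry`, either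
orientation via `symbolicDet_ne_zero_comm`), x-certificate pairs by `XElim.symbolicDet_ne_zero_of_isXCertPair`, the rest by the node. -/
theorem stub_ltRestNonCanonRSW_of_rswp (hR : Stmt.stub_ltRestNonCanonRSWP) : Stmt.stub_ltRestNonCanonRSW := by
  obtain ⟨s, h₀, hs, H⟩ := hR
  refine ⟨s, h₀, by omega, ?_⟩
  intro h hh r u w hu hw hlu hlw hr h₁ h₂ h₃ h₄ h₅ h₆ h₇ h₈ h₉ h₁₀ h₁₁ h₁₂
  by_cases hP : ∃ (a c : Fin r → ℕ) (Θ : Finset (Fin h) × Finset (Fin h) → ℂ) (Φ Ψ : Finset (Fin h) × Finset (Fin h) → Fin h → ℂ),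
      (∀ i j, a i ≤ c j ∨ a i + s * (u i).card ≤ (w j).card + c j) ∧
      (Matrix.of fun i j : Fin r => if c j ≤ a i then PT.ptEntry s (a i - c j) Θ Φ Ψ (w j) (u i) else 0).det ≠ 0
  · obtain ⟨a, c, Θ, Φ, Ψ, hac, hdet⟩ := hP
    exact PT.symbolicDet_ne_zero_of_ptEntry Θ Φ Ψ u w a c hac hdet
  by_cases hP' : ∃ (a c : Fin r → ℕ) (Θ : Finset (Fin h) × Finset (Fin h) → ℂ) (Φ Ψ : Finset (Fin h) × Finset (Fin h) → Fin h → ℂ),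
      (∀ i j, a i ≤ c j ∨ a i + s * (w i).card ≤ (u j).card + c j) ∧
      (Matrix.of fun i j : Fin r => if c j ≤ a i then PT.ptEntry s (a i - c j) Θ Φ Ψ (u j) (w i) else 0).det ≠ 0
  · obtain ⟨a, c, Θ, Φ, Ψ, hac, hdet⟩ := hP'
    exact (symbolicDet_ne_zero_comm s h r u w).mpr (PT.symbolicDet_ne_zero_of_ptEntry Θ Φ Ψ w u a c hac hdet)
  by_cases hX : XElim.IsXCertPair u w
  · exact XElim.symbolicDet_ne_zero_of_isXCertPair hs hu hw hX
  by_cases hX' : XElim.IsXCertPair w u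
  · exact (symbolicDet_ne_zero_comm s h r u w).mpr (XElim.symbolicDet_ne_zero_of_isXCertPair hs hw hu hX')
  exact H h hh r u w hu hw hlu hlw hr h₁ h₂ h₃ h₄ h₅ h₆ h₇ h₈ h₉ h₁₀ h₁₁ h₁₂ hP hP' hX hX'

/-- **Composition BY NAME: the registered node v28b ALONE closes the support item `AnchoredDoorHitsLowerPairs`** (via the v26 node, p691725/p695484). -/
theorem anchoredDoorHitsLowerPairs_of_ltRestNonCanonRSWP (hR : Stmt.stub_ltRestNonCanonRSWP) :
    Summit.ValiantsHypothesis.ValiantsHypothesis.Theses.BarrierLever.AnchoredDoorHitsLowerPairs :=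
  anchoredDoorHitsLowerPairs_of_ltRestNonCanonRSW (stub_ltRestNonCanonRSW_of_rswp hR)

/-! ## 3. The residual minus distinct-anchor pairs -/

/-- **STUB TEXT (offered, val-np-p1 g27): THE REGISTERED RESIDUAL MINUS DISTINCT-ANCHOR PAIRS.** `Stmt.stub_ltRestNonCanonRSWP` VERBATIM with two further
hypotheses: no system of distinct anchors at profile `s` (`DistinctAnchors.IsDAPair s`) in either orientation. WEAKER than RSWP — UNCONDITIONALLY (glue
`stub_ltRestNonCanonRSWP_of_rswpd`; distinct-anchor pairs are hit by val-np-p4 g16's theorem): a 1:1 weakest-node narrowing candidate. MEMBERS: by the min-cut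
form of the Hall condition, only pairs with a deep sub-complex against few small faces (memo g27 §2); no explicit member is known at `s = 2` below r ≈ 10⁸.
WHY IT MIGHT FAIL: a deep × wide lower pair (e.g. cube_n against a 2-dimensional column complex, n ≳ 28) whose symbolic minor vanishes at the chosen profile. -/
def Stmt.stub_ltRestNonCanonRSWPD : Prop :=
  ∃ s h₀ : ℕ, 2 ≤ s ∧ ∀ h : ℕ, h₀ ≤ h → ∀ (r : ℕ) (u w : Fin r → Finset (Fin h)),
    Function.Injective u → Function.Injective w → IsLowerSet (Set.range u) → IsLowerSet (Set.range w) → 2 ≤ r →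
    (∀ (a : Fin h) (W₀ : Finset (Fin h)) (𝒜 : Finset (Finset (Fin h))) (ρ : Finset (Fin h) → Finset (Fin h)), ¬ UQFData s u w a W₀ 𝒜 ρ) →
    (∀ (c : Fin h) (Z : Finset (Fin h)) (𝒜 : Finset (Finset (Fin h))) (ρ : Finset (Fin h) → Finset (Fin h)), ¬ UQFData s w u c Z 𝒜 ρ) →
    ¬ Summit.ValiantsHypothesis.ValiantsHypothesis.Theorems.BarrierLever.AnchoredPeeling.IsRelApexPair u w → ¬ Summit.ValiantsHypothesis.ValiantsHypothesis.Theorems.BarrierLever.AnchoredPeeling.IsRelApexPair w u → ¬ Summit.ValiantsHypothesis.ValiantsHypothesis.Theorems.BarrierLever.AnchoredPeeling.LTCert u w → ¬ Summit.ValiantsHypothesis.ValiantsHypothesis.Theorems.BarrierLever.AnchoredPeeling.LTCert w u →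
    (¬ ∃ (k : ℕ) (σ τ : Equiv.Perm (Fin h)), 1 ≤ k ∧ 2 * k + 1 ≤ h ∧ 2 ^ (k + 1) - 1 ≤ h ∧
        (∀ U : Finset (Fin h), U ∈ Set.range u ↔ Summit.ValiantsHypothesis.ValiantsHypothesis.Theorems.BarrierLever.AnchoredPeeling.DecRow k h (U.map σ.toEmbedding)) ∧
        (∀ W : Finset (Fin h), W ∈ Set.range w ↔ Summit.ValiantsHypothesis.ValiantsHypothesis.Theorems.BarrierLever.AnchoredPeeling.DecCol k h (W.map τ.toEmbedding))) →
    (¬ ∃ (k : ℕ) (σ τ : Equiv.Perm (Fin h)), 1 ≤ k ∧ 2 * k + 1 ≤ h ∧ 2 ^ (k + 1) - 1 ≤ h ∧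
        (∀ U : Finset (Fin h), U ∈ Set.range w ↔ Summit.ValiantsHypothesis.ValiantsHypothesis.Theorems.BarrierLever.AnchoredPeeling.DecRow k h (U.map σ.toEmbedding)) ∧
        (∀ W : Finset (Fin h), W ∈ Set.range u ↔ Summit.ValiantsHypothesis.ValiantsHypothesis.Theorems.BarrierLever.AnchoredPeeling.DecCol k h (W.map τ.toEmbedding))) →
    (¬ ∃ (m : ℕ) (σ τ : Equiv.Perm (Fin h)), 1 ≤ m ∧ 2 * m + 2 ≤ h ∧ 2 ^ (m + 1) + 2 ^ m - 1 ≤ h ∧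
        (∀ U : Finset (Fin h), U ∈ Set.range u ↔ Summit.ValiantsHypothesis.ValiantsHypothesis.Theorems.BarrierLever.AnchoredPeeling.SplitRow m h (U.map σ.toEmbedding)) ∧
        (∀ W : Finset (Fin h), W ∈ Set.range w ↔ Summit.ValiantsHypothesis.ValiantsHypothesis.Theorems.BarrierLever.AnchoredPeeling.SplitCol m h (W.map τ.toEmbedding))) →
    (¬ ∃ (m : ℕ) (σ τ : Equiv.Perm (Fin h)), 1 ≤ m ∧ 2 * m + 2 ≤ h ∧ 2 ^ (m + 1) + 2 ^ m - 1 ≤ h ∧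
        (∀ U : Finset (Fin h), U ∈ Set.range w ↔ Summit.ValiantsHypothesis.ValiantsHypothesis.Theorems.BarrierLever.AnchoredPeeling.SplitRow m h (U.map σ.toEmbedding)) ∧
        (∀ W : Finset (Fin h), W ∈ Set.range u ↔ Summit.ValiantsHypothesis.ValiantsHypothesis.Theorems.BarrierLever.AnchoredPeeling.SplitCol m h (W.map τ.toEmbedding))) →
    ¬ _root_.Summit.ValiantsHypothesis.ValiantsHypothesis.Theorems.BarrierLever.AnchoredPeeling.IsWApexPair u w → ¬ _root_.Summit.ValiantsHypothesis.ValiantsHypothesis.Theorems.BarrierLever.AnchoredPeeling.IsWApexPair w u →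
    (¬ ∃ (a c : Fin r → ℕ) (Θ : Finset (Fin h) × Finset (Fin h) → ℂ) (Φ Ψ : Finset (Fin h) × Finset (Fin h) → Fin h → ℂ),
        (∀ i j, a i ≤ c j ∨ a i + s * (u i).card ≤ (w j).card + c j) ∧
        (Matrix.of fun i j : Fin r => if c j ≤ a i then _root_.Summit.ValiantsHypothesis.ValiantsHypothesis.Theorems.BarrierLever.AnchoredPeeling.PT.ptEntry s (a i - c j) Θ Φ Ψ (w j) (u i) else 0).det ≠ 0) →
    (¬ ∃ (a c : Fin r → ℕ) (Θ : Finset (Fin h) × Finset (Fin h) → ℂ) (Φ Ψ : Finset (Fin h) × Finset (Fin h) → Fin h → ℂ),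
        (∀ i j, a i ≤ c j ∨ a i + s * (w i).card ≤ (u j).card + c j) ∧
        (Matrix.of fun i j : Fin r => if c j ≤ a i then _root_.Summit.ValiantsHypothesis.ValiantsHypothesis.Theorems.BarrierLever.AnchoredPeeling.PT.ptEntry s (a i - c j) Θ Φ Ψ (u j) (w i) else 0).det ≠ 0) →
    ¬ _root_.Summit.ValiantsHypothesis.ValiantsHypothesis.Theorems.BarrierLever.AnchoredPeeling.XElim.IsXCertPair u w → ¬ _root_.Summit.ValiantsHypothesis.ValiantsHypothesis.Theorems.BarrierLever.AnchoredPeeling.XElim.IsXCertPair w u →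
    ¬ DistinctAnchors.IsDAPair s u w → ¬ DistinctAnchors.IsDAPair s w u →
    symbolicDet s h r u w ≠ 0

/-- **Kernel glue (UNCONDITIONAL; weakest-node narrowing candidate): the residual minus distinct-anchor pairs ⟹ the registered node v28b.** -/
theorem stub_ltRestNonCanonRSWP_of_rswpd (hR : Stmt.stub_ltRestNonCanonRSWPD) : Stmt.stub_ltRestNonCanonRSWP := by
  obtain ⟨s, h₀, hs, H⟩ := hR
  refine ⟨s, h₀, hs, ?_⟩
  intro h hh r u w hu hw hlu hlw hr h₁ h₂ h₃ h₄ h₅ h₆ h₇ h₈ h₉ h₁₀ h₁₁ h₁₂ hP hP' hX hX'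
  by_cases hD : DistinctAnchors.IsDAPair s u w
  · exact DistinctAnchors.symbolicDet_ne_zero_of_isDAPair hu hw hD
  by_cases hD' : DistinctAnchors.IsDAPair s w u
  · exact DistinctAnchors.symbolicDet_ne_zero_of_isDAPair_swap hu hw hD'
  exact H h hh r u w hu hw hlu hlw hr h₁ h₂ h₃ h₄ h₅ h₆ h₇ h₈ h₉ h₁₀ h₁₁ h₁₂ hP hP' hX hX' hD hD'

/-- **Composition BY NAME: the residual minus distinct-anchor pairs ⟹ the support item `AnchoredDoorHitsLowerPairs`.** -/
theorem anchoredDoorHitsLowerPairs_of_ltRestNonCanonRSWPD (hR : Stmt.stub_ltRestNonCanonRSWPD) :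
    Summit.ValiantsHypothesis.ValiantsHypothesis.Theses.BarrierLever.AnchoredDoorHitsLowerPairs :=
  anchoredDoorHitsLowerPairs_of_ltRestNonCanonRSWP (stub_ltRestNonCanonRSWP_of_rswpd hR)

end Summit.ValiantsHypothesis.ValiantsHypothesis.Theorems.BarrierLever.AnchoredPeeling
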